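import Mathlib
import Literature.LinearAlgebra.QuadraticForm.ArfInvariant
import HarnessLib

/-!
# X5 / O1 · Selmer solitaire — the 𝔽₂ matching-parity calculus of principal minors

Support file for the o1 cell's PROVER ORDER v2.8 (ii′) (`cells/o1/PLAN.md` C69; lens-2 G5.3/G5.10
`O1Stub2Sketch.lean`): `PivotRebase`, `OnePrimeConnection` (T4), `Bad1ThreePrimeConnection` (T4′)
are statements about `Core P n := det Ŝ[n⁺] = 1` for a symmetric zero-diagonal matrix over `𝔽₂`,
and such a principal minor is the PARITY OF THE NUMBER OF PERFECT MATCHINGS of the graph on the index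
set (Pfaffian mod `2`; lens-2 G5.4 "odd-matching minors"). For `S : Matrix ι ι (ZMod 2)` symmetric
with zero diagonal and `det S[X] := (S.submatrix (fun a : ↥X => (a : ι)) (fun a : ↥X => (a : ι))).det`
(EXACTLY the term `Core` unfolds to) this file proves, in the sub-namespace `…SelmerSolitaire.Matching`
(o1 lead R-G18.3): §0 transfer along an injective enumeration (`det_submatrix_eq_det_principal`),
`det S[∅] = 1`; (M1) `det_principal_eq_sum_erase`, VERTEX EXPANSION
`det S[X] = Σ_{y ∈ X∖x} S x y · det S[X∖{x,y}]` at ANY `x ∈ X` (double Laplace; cross cofactors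
cancel in characteristic `2` by symmetry) and (PEEL) `exists_erase_erase_det_eq_one`; (M2)
`det_principal_eq_zero_of_odd`; (M3) KERNEL lemma `sum_mul_det_principal_erase_eq_zero`
(`Σ_{y ∈ Y∖t} S t y · det S[Y∖y] = 0`, `t ∈ Y`); (M5) `det_principal_insert_eq_sum`, ONE-VERTEX
EXTENSION read-out (`q ∉ Y` ⟹ `det S[Y ∪ {q}] = Σ_{x ∈ Y} S q x · det S[Y∖x]`, linear in the new
row); (M4) `sum_det_principal_insert_mul_erase_eq_zero`, EXCHANGE identity (`|Z|` odd, `R ∩ Z = ∅`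
⟹ `Σ_{t ∈ R} det S[Z ∪ {t}] · det S[(Z ∪ R)∖t] = 0`; for `|R| = 4` the Pfaffian Plücker relation
mod `2` = lens-2's T4 Step-4 block-inversion identity in matching form).
Imports Mathlib + HarnessLib + the tree's `Literature.LinearAlgebra.QuadraticForm.ArfInvariant` (for
`zmod_two_mul_self` only); THEOREMS ONLY (no definition, no named fact, no `sorry`); copies no
declaration of the lens-2 sketch / `SelmerSolitairePivot*` / `SelmerSolitaireAlternating`. Cell
`b2b-bsdres`, seat x11b3-p3 (director's pool hand on o1 ORDER (ii′)). HONEST FRAMING: research route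
O1 (p = 2); reach-neutral combinatorial support; nothing booked; no mark moved.
-/

namespace Summit.BirchSwinnertonDyer.Rank1Residual.X5.SelmerSolitaire.Matching

open Matrix Finset

variable {ι : Type*} [DecidableEq ι]
/-! ## §0. Transfer: principal minors along an injective enumeration -/

/-- Over `ZMod 2` the sign `(-1)^n` is `1`. [folklore] -/
theorem neg_one_pow_eq_one_zmod_two (n : ℕ) : ((-1 : ZMod 2)) ^ n = 1 := by
  have : (-1 : ZMod 2) = 1 := by decide
  simp [this]

/-- **Transfer lemma.** The principal minor of `S` on `Y` (subtype-indexed, as in the sketch's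
`Core`) equals `det (S.submatrix f f)` for ANY injective enumeration `f : Fin m → ι` of `Y`.
[folklore] -/
theorem det_submatrix_eq_det_principal {R : Type*} [CommRing R] (S : Matrix ι ι R) {m : ℕ}
    (Y : Finset ι) (f : Fin m → ι) (hf : Function.Injective f) (hY : ∀ i, f i ∈ Y)
    (hm : Y.card = m) :
    (S.submatrix f f).det = (S.submatrix (fun a : ↥Y => (a : ι)) (fun a : ↥Y => (a : ι))).det := by
  classical
  let g : Fin m → ↥Y := fun i => ⟨f i, hY i⟩
  have hg : Function.Bijective g := by
    rw [Fintype.bijective_iff_injective_and_card]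
    refine ⟨fun i j h => hf (by simpa [g] using congrArg Subtype.val h), by simp [hm]⟩
  have : S.submatrix f f =
      (S.submatrix (fun a : ↥Y => (a : ι)) (fun a : ↥Y => (a : ι))).submatrix
        (Equiv.ofBijective g hg) (Equiv.ofBijective g hg) := by
    ext i j
    rfl
  rw [this, Matrix.det_submatrix_equiv_self]

/-- The empty principal minor is `1`. [folklore] -/
theorem det_principal_empty {R : Type*} [CommRing R] (S : Matrix ι ι R) :
    (S.submatrix (fun a : ↥(∅ : Finset ι) => (a : ι)) (fun a : ↥(∅ : Finset ι) => (a : ι))).det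
      = 1 :=
  Matrix.det_isEmpty



/-! ## §1. (M1) Vertex expansion of a principal minor of an alternating matrix over `𝔽₂` -/

section Expansion

variable (S : Matrix ι ι (ZMod 2))

omit [DecidableEq ι] in
/-- The `(i, j)` / `(j, i)` cross minors of a symmetric matrix have equal determinants.
[folklore] -/
theorem det_submatrix_succAbove_comm (hS : S.IsSymm) {k : ℕ} (g : Fin (k + 1) → ι)
    (i j : Fin (k + 1)) :
    (S.submatrix (g ∘ j.succAbove) (g ∘ i.succAbove)).det =
      (S.submatrix (g ∘ i.succAbove) (g ∘ j.succAbove)).det := by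
  rw [← Matrix.det_transpose (S.submatrix (g ∘ i.succAbove) (g ∘ j.succAbove)),
    Matrix.transpose_submatrix, hS.eq]

/-- A symmetric function summed over ordered pairs of a finite type reduces, in characteristic `2`,
to its diagonal (the off-diagonal pairs cancel). [folklore] -/
theorem sum_sum_eq_sum_diag_of_symm {κ : Type*} [Fintype κ] [DecidableEq κ]
    (F : κ → κ → ZMod 2) (hF : ∀ i j, F i j = F j i) :
    ∑ i, ∑ j, F i j = ∑ i, F i i := by
  classical
  rw [← Finset.sum_product' (f := fun i j => F i j), ← Finset.sum_filter_add_sum_filter_not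
    (s := (Finset.univ : Finset κ) ×ˢ Finset.univ) (p := fun p : κ × κ => p.1 = p.2)]
  have hdiag : ∑ p ∈ (Finset.univ ×ˢ Finset.univ).filter (fun p : κ × κ => p.1 = p.2), F p.1 p.2
      = ∑ i, F i i := by
    rw [Finset.sum_filter]
    rw [Finset.sum_product]
    refine Finset.sum_congr rfl fun i _ => ?_
    simp
  have hoff : ∑ p ∈ (Finset.univ ×ˢ Finset.univ).filter (fun p : κ × κ => ¬ p.1 = p.2), F p.1 p.2
      = 0 := by
    refine Finset.sum_involution (fun p _ => p.swap) ?_ ?_ ?_ ?_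
    · intro p hp
      rw [Prod.fst_swap, Prod.snd_swap, hF p.2 p.1, ← two_mul, show (2 : ZMod 2) = 0 from by decide,
        zero_mul]
    · intro p hp _ h
      simp only [Finset.mem_filter] at hp
      exact hp.2 (by simpa using (congrArg Prod.fst h).symm)
    · intro p hp
      simp only [Finset.mem_filter, Finset.mem_product, Finset.mem_univ, true_and] at hp ⊢
      exact fun h => hp h.symm
    · intro p hp; simp
  rw [hdiag, hoff, add_zero]

omit [DecidableEq ι] in
/-- Double Laplace expansion of `det S[x ∷ g]` around `x` (row `0`, then column `0` of each
cofactor) for symmetric zero-diagonal `S` over `ZMod 2`: only the diagonal cofactors survive,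
`det (S.submatrix (x ∷ g) (x ∷ g)) = Σ_i S x (g i) · det (S.submatrix (g ∘ î) (g ∘ î))`.
[folklore] -/
theorem det_submatrix_cons_cons (hS : S.IsSymm) (hd : ∀ i, S i i = 0) {k : ℕ}
    (x : ι) (g : Fin (k + 1) → ι) :
    (S.submatrix (Fin.cons x g : Fin (k + 2) → ι) (Fin.cons x g : Fin (k + 2) → ι)).det =
      ∑ i : Fin (k + 1), S x (g i) *
        (S.submatrix (g ∘ i.succAbove) (g ∘ i.succAbove)).det := by
  have hgs : ((Fin.cons x g : Fin (k + 2) → ι) ∘ Fin.succ) = g :=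
    funext fun i => by simp
  -- Laplace along row `0`
  rw [Matrix.det_succ_row_zero, Fin.sum_univ_succ]
  simp only [neg_one_pow_eq_one_zmod_two, one_mul, Matrix.submatrix_apply,
    Matrix.submatrix_submatrix, Fin.cons_zero, Fin.cons_succ, hd x, zero_mul, zero_add, hgs]
  -- Laplace along column `0` of each cofactor
  have hcol : ∀ j : Fin (k + 1),
      (S.submatrix g ((Fin.cons x g : Fin (k + 2) → ι) ∘ j.succ.succAbove)).det =
        ∑ i : Fin (k + 1), S (g i) x *
          (S.submatrix (g ∘ i.succAbove) (g ∘ j.succAbove)).det := by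
    intro j
    rw [Matrix.det_succ_column_zero]
    refine Finset.sum_congr rfl fun i _ => ?_
    have h2 : (j.succ.succAbove ∘ Fin.succ : Fin k → Fin (k + 2)) = Fin.succ ∘ j.succAbove :=
      funext fun a => Fin.succ_succAbove_succ j a
    simp only [neg_one_pow_eq_one_zmod_two, one_mul, Matrix.submatrix_apply,
      Matrix.submatrix_submatrix, Function.comp_apply, Fin.succ_succAbove_zero, Fin.cons_zero]
    congr 2
    rw [Function.comp_assoc, h2, ← Function.comp_assoc, hgs]
  simp_rw [hcol, Finset.mul_sum]
  -- keep the diagonal only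
  rw [sum_sum_eq_sum_diag_of_symm (fun j i => S x (g j) * (S (g i) x *
    (S.submatrix (g ∘ i.succAbove) (g ∘ j.succAbove)).det))]
  · refine Finset.sum_congr rfl fun i _ => ?_
    rw [hS.apply (g i) x, ← mul_assoc, Literature.LinearAlgebra.QuadraticForm.zmod_two_mul_self]
  · intro i j
    rw [det_submatrix_succAbove_comm S hS g i j, hS.apply (g i) x, hS.apply (g j) x]
    ring

/-- **(M1) Vertex expansion.** For symmetric zero-diagonal `S` over `ZMod 2` and `x ∈ X`:
`det S[X] = Σ_{y ∈ X∖x} S x y · det S[X∖{x,y}]` (the parity of perfect matchings of the graph `S` on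
`X`, expanded along the partner of `x`): Laplace along the row of `x`, then the column of `x` in
each cofactor; the cross terms `(y,z)/(z,y)` cancel in characteristic `2` by symmetry. [folklore] -/
theorem det_principal_eq_sum_erase (hS : S.IsSymm) (hd : ∀ i, S i i = 0) (X : Finset ι) {x : ι}
    (hx : x ∈ X) :
    (S.submatrix (fun a : ↥X => (a : ι)) (fun a : ↥X => (a : ι))).det =
      ∑ y ∈ X.erase x, S x y *
        (S.submatrix (fun a : ↥((X.erase x).erase y) => (a : ι))
          (fun a : ↥((X.erase x).erase y) => (a : ι))).det := by
  classical
  -- enumerate `X ∖ x` by `g : Fin k → ι` and `X` by `f = Fin.cons x g`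
  obtain ⟨k, hk⟩ : ∃ k, (X.erase x).card = k := ⟨_, rfl⟩
  obtain ⟨e₁⟩ : Nonempty (↥(X.erase x) ≃ Fin k) := ⟨Fintype.equivFinOfCardEq (by simp [hk])⟩
  let g : Fin k → ι := fun i => ((e₁.symm i : ↥(X.erase x)) : ι)
  have hg_mem : ∀ i, g i ∈ X.erase x := fun i => (e₁.symm i).2
  have hg_inj : Function.Injective g := fun i j h => e₁.symm.injective (Subtype.ext h)
  let f : Fin (k + 1) → ι := Fin.cons x g
  have hfs : ∀ i : Fin k, f i.succ = g i := fun i => by simp [f]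
  have hf_inj : Function.Injective f := by
    refine Fin.cons_injective_iff.mpr ⟨?_, hg_inj⟩
    rintro ⟨i, hi⟩
    exact (Finset.ne_of_mem_erase (hi ▸ hg_mem i)) rfl
  have hf_mem : ∀ i, f i ∈ X := by
    intro i
    refine Fin.cases ?_ (fun j => ?_) i
    · exact hx
    · rw [hfs]; exact Finset.mem_of_mem_erase (hg_mem j)
  have hXcard : X.card = k + 1 := by rw [← hk, Finset.card_erase_add_one hx]
  -- the sum over `X ∖ x` as a sum over `Fin k`
  have hsum : ∑ y ∈ X.erase x, S x y *
        (S.submatrix (fun a : ↥((X.erase x).erase y) => (a : ι))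
          (fun a : ↥((X.erase x).erase y) => (a : ι))).det =
      ∑ i : Fin k, S x (g i) *
        (S.submatrix (fun a : ↥((X.erase x).erase (g i)) => (a : ι))
          (fun a : ↥((X.erase x).erase (g i)) => (a : ι))).det := by
    rw [← Finset.sum_coe_sort (X.erase x)]
    exact (Fintype.sum_equiv e₁.symm _ _ fun i => rfl).symm
  rw [hsum, ← det_submatrix_eq_det_principal S X f hf_inj hf_mem hXcard]
  cases k with
  | zero =>
    -- `X = {x}`: a `1 × 1` zero-diagonal determinant
    rw [Finset.univ_eq_empty, Finset.sum_empty]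
    have h1 : (S.submatrix f f).det = S (f 0) (f 0) := Matrix.det_fin_one (S.submatrix f f)
    exact h1.trans (hd _)
  | succ k =>
    rw [det_submatrix_cons_cons S hS hd x g]
    refine Finset.sum_congr rfl fun i _ => ?_
    congr 1
    refine det_submatrix_eq_det_principal S _ _ (hg_inj.comp Fin.succAbove_right_injective) ?_ ?_
    · intro a
      exact Finset.mem_erase.mpr ⟨fun h => Fin.succAbove_ne i a (hg_inj h), hg_mem _⟩
    · rw [Finset.card_erase_of_mem (hg_mem i), hk, Nat.add_sub_cancel]

/-- **(PEEL)** — lens-2's "Jacobi chain" step without inverses: if `det S[X] = 1` and `x ∈ X` then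
some `y ∈ X ∖ x` has `S x y = 1` and `det S[X ∖ {x,y}] = 1` (a term of the vertex expansion (M1)
must be `1`). With `X = B ∪ {∞}`, `x = ∞` it peels the top element of an odd core `B`. [folklore] -/
theorem exists_erase_erase_det_eq_one (hS : S.IsSymm) (hd : ∀ i, S i i = 0) (X : Finset ι) {x : ι}
    (hx : x ∈ X) (hX : (S.submatrix (fun a : ↥X => (a : ι)) (fun a : ↥X => (a : ι))).det = 1) :
    ∃ y ∈ X.erase x, S x y = 1 ∧
      (S.submatrix (fun a : ↥((X.erase x).erase y) => (a : ι))
        (fun a : ↥((X.erase x).erase y) => (a : ι))).det = 1 := by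
  rw [det_principal_eq_sum_erase S hS hd X hx] at hX
  obtain ⟨y, hy, hne⟩ := Finset.exists_ne_zero_of_sum_ne_zero (by rw [hX]; exact one_ne_zero)
  refine ⟨y, hy, ?_⟩
  revert hne
  generalize S x y = a
  generalize (S.submatrix (fun b : ↥((X.erase x).erase y) => (b : ι))
    (fun b : ↥((X.erase x).erase y) => (b : ι))).det = b
  revert a b
  decide
/-! ## §2. (M2) Odd principal minors vanish; (M3) the kernel lemma -/

/-- **(M2) Odd principal minors of an alternating matrix over `𝔽₂` vanish**: if `|X|` is odd then
`det S[X] = 0` (a graph on an odd vertex set has no perfect matching). Induction on `|X|` via the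
vertex expansion (M1). [folklore] -/
theorem det_principal_eq_zero_of_odd (hS : S.IsSymm) (hd : ∀ i, S i i = 0) :
    ∀ (X : Finset ι), Odd X.card →
      (S.submatrix (fun a : ↥X => (a : ι)) (fun a : ↥X => (a : ι))).det = 0 := by
  intro X
  induction' hN : X.card using Nat.strong_induction_on with N ih generalizing X
  intro hodd
  have hne : X.Nonempty := by
    rw [← Finset.card_pos, hN]
    exact hodd.pos
  obtain ⟨x, hx⟩ := hne
  rw [det_principal_eq_sum_erase S hS hd X hx]
  refine Finset.sum_eq_zero fun y hy => ?_
  have hcard : ((X.erase x).erase y).card = N - 2 := by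
    rw [Finset.card_erase_of_mem hy, Finset.card_erase_of_mem hx, hN]
    omega
  have h2 : 2 ≤ N := by
    have h1 : 1 ≤ (X.erase x).card := Finset.card_pos.mpr ⟨y, hy⟩
    rw [Finset.card_erase_of_mem hx, hN] at h1
    omega
  rw [ih (N - 2) (by omega) ((X.erase x).erase y) hcard ?_, mul_zero]
  rcases hodd with ⟨m, hm⟩
  exact ⟨m - 1, by omega⟩

/-- **(M3) Kernel lemma.** For `|Y|` odd and `t ∈ Y`:
`Σ_{y ∈ Y∖t} S t y · det S[Y∖y] = 0` — the vector of complementary principal minors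
`(det S[Y∖y])_y` lies in the kernel of the odd alternating matrix `S[Y]` (row `t`; the diagonal
term is absent as `S t t = 0`). Proof: expand each `det S[Y∖y]` at `t` by (M1); the resulting
double sum over ordered pairs `y ≠ z` of `Y∖t` is symmetric, hence `0` in characteristic `2`.
[folklore] -/
theorem sum_mul_det_principal_erase_eq_zero (hS : S.IsSymm) (hd : ∀ i, S i i = 0)
    (Y : Finset ι) {t : ι} (ht : t ∈ Y) :
    ∑ y ∈ Y.erase t, S t y *
      (S.submatrix (fun a : ↥(Y.erase y) => (a : ι)) (fun a : ↥(Y.erase y) => (a : ι))).det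
      = 0 := by
  classical
  -- expand every `det S[Y ∖ y]` at `t`
  have hexp : ∀ y ∈ Y.erase t,
      (S.submatrix (fun a : ↥(Y.erase y) => (a : ι)) (fun a : ↥(Y.erase y) => (a : ι))).det =
        ∑ z ∈ (Y.erase t).erase y, S t z *
          (S.submatrix (fun a : ↥(((Y.erase t).erase y).erase z) => (a : ι))
            (fun a : ↥(((Y.erase t).erase y).erase z) => (a : ι))).det := by
    intro y hy
    have hty : t ∈ Y.erase y := Finset.mem_erase.mpr ⟨(Finset.ne_of_mem_erase hy).symm, ht⟩
    rw [det_principal_eq_sum_erase S hS hd (Y.erase y) hty,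
      Finset.erase_right_comm (s := Y) (a := y) (b := t)]
  rw [Finset.sum_congr rfl fun y hy => by rw [hexp y hy, Finset.mul_sum]]
  -- the double sum over ordered pairs `y ≠ z` of a symmetric function vanishes
  rw [Finset.sum_sigma' (Y.erase t) (fun y => (Y.erase t).erase y)]
  refine Finset.sum_involution (fun p _ => ⟨p.2, p.1⟩) ?_ ?_ ?_ ?_
  · rintro ⟨y, z⟩ hp
    simp only [Finset.mem_sigma, Finset.mem_erase] at hp
    rw [Finset.erase_right_comm (s := Y.erase t) (a := z) (b := y), ← mul_assoc, ← mul_assoc,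
      mul_comm (S t z) (S t y), ← two_mul]
    rw [show (2 : ZMod 2) = 0 from by decide, zero_mul]
  · rintro ⟨y, z⟩ hp _
    simp only [Finset.mem_sigma, Finset.mem_erase] at hp
    intro h
    simp only [Sigma.mk.inj_iff, heq_eq_eq] at h
    exact hp.2.1 h.2.symm
  · rintro ⟨y, z⟩ hp
    simp only [Finset.mem_sigma, Finset.mem_erase] at hp ⊢
    exact ⟨⟨hp.2.2.1, hp.2.2.2⟩, fun h => hp.2.1 h.symm, hp.1.1, hp.1.2⟩
  · rintro ⟨y, z⟩ hp
    rfl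
/-! ## §3. (M5) one-vertex extension read-out; (M4) the exchange identity -/

/-- **(M5) One-vertex extension read-out.** For `q ∉ Y`:
`det S[Y ∪ {q}] = Σ_{x ∈ Y} S q x · det S[Y ∖ x]` — the principal minor of the extended graph is
LINEAR in the new vertex's adjacency row, with coefficients the complementary minors of `Y`
((M1) at the new vertex; this is how every `Core P' (… ∪ {q})` test of T4 / T4′ is read).
[folklore] -/
theorem det_principal_insert_eq_sum (hS : S.IsSymm) (hd : ∀ i, S i i = 0) (Y : Finset ι)
    {q : ι} (hq : q ∉ Y) :
    (S.submatrix (fun a : ↥(insert q Y) => (a : ι)) (fun a : ↥(insert q Y) => (a : ι))).det =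
      ∑ x ∈ Y, S q x *
        (S.submatrix (fun a : ↥(Y.erase x) => (a : ι)) (fun a : ↥(Y.erase x) => (a : ι))).det := by
  rw [det_principal_eq_sum_erase S hS hd (insert q Y) (Finset.mem_insert_self q Y),
    Finset.erase_insert hq]

/-- **(M4) Exchange identity** (Pfaffian Plücker relation mod `2`). For `|Z|` odd and `R`
disjoint from `Z`: `Σ_{t ∈ R} det S[Z ∪ {t}] · det S[(Z ∪ R) ∖ t] = 0`. (For `|R| = 4` and
`Z = n ∖ x` this is the identity `w_{n∪{u,v}} = (w_n, 0, 0) + α_v κ_{n,u} + α_u κ_{n,v}` of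
lens-2's T4 Step 4, in matching form.) Proof: expand `det S[Z ∪ {t}]` at `t` (M5), swap the sums,
apply the kernel lemma (M3) in `Z ∪ R` at each `y ∈ Z` to trade the sum over `R` for a sum over
`Z ∖ y`, swap again and apply (M3) in `Z`. [folklore] -/
theorem sum_det_principal_insert_mul_erase_eq_zero (hS : S.IsSymm) (hd : ∀ i, S i i = 0)
    (Z R : Finset ι) (hZR : Disjoint Z R) (hZ : Odd Z.card) :
    ∑ t ∈ R,
      (S.submatrix (fun a : ↥(insert t Z) => (a : ι)) (fun a : ↥(insert t Z) => (a : ι))).det *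
      (S.submatrix (fun a : ↥((Z ∪ R).erase t) => (a : ι))
        (fun a : ↥((Z ∪ R).erase t) => (a : ι))).det = 0 := by
  classical
  -- if `|R|` is odd every second factor is an odd minor
  rcases Nat.even_or_odd R.card with hR | hR
  swap
  · refine Finset.sum_eq_zero fun t ht => ?_
    rw [det_principal_eq_zero_of_odd S hS hd ((Z ∪ R).erase t) ?_, mul_zero]
    rw [Finset.card_erase_of_mem (Finset.mem_union_right Z ht), Finset.card_union_of_disjoint hZR]
    rcases hZ with ⟨a, ha⟩; rcases hR with ⟨b, hb⟩; exact ⟨a + b, by omega⟩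
  -- `Y = Z ∪ R` is odd
  set Y := Z ∪ R with hY
  have hYodd : Odd Y.card := by
    rw [hY, Finset.card_union_of_disjoint hZR]; exact hZ.add_even hR
  have htZ : ∀ t ∈ R, t ∉ Z := fun t ht htZ => Finset.disjoint_left.mp hZR htZ ht
  -- name the two families of complementary minors
  set dZ : ι → ZMod 2 := fun y =>
    (S.submatrix (fun a : ↥(Z.erase y) => (a : ι)) (fun a : ↥(Z.erase y) => (a : ι))).det with hdZ
  set dY : ι → ZMod 2 := fun t =>
    (S.submatrix (fun a : ↥(Y.erase t) => (a : ι)) (fun a : ↥(Y.erase t) => (a : ι))).det with hdY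
  -- (a) expand the first factor at `t`, (b) swap the sums
  have hab : ∑ t ∈ R,
      (S.submatrix (fun a : ↥(insert t Z) => (a : ι)) (fun a : ↥(insert t Z) => (a : ι))).det *
        dY t = ∑ y ∈ Z, dZ y * ∑ t ∈ R, S y t * dY t := by
    rw [Finset.sum_congr rfl fun t ht => by
      rw [det_principal_insert_eq_sum S hS hd Z (htZ t ht), Finset.sum_mul], Finset.sum_comm]
    refine Finset.sum_congr rfl fun y hy => ?_
    rw [Finset.mul_sum]
    refine Finset.sum_congr rfl fun t ht => ?_
    rw [hS.apply y t]
    ring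
  -- (c) for `y ∈ Z`, trade the sum over `R` for the sum over `Z ∖ y` by the kernel lemma in `Y`
  have hker : ∀ y ∈ Z, ∑ t ∈ R, S y t * dY t = ∑ t ∈ Z.erase y, S y t * dY t := by
    intro y hy
    have h0 := sum_mul_det_principal_erase_eq_zero S hS hd Y (Finset.mem_union_left R hy)
    have hsplit : Y.erase y = Z.erase y ∪ R := by
      rw [hY, Finset.erase_union_distrib, Finset.erase_eq_of_notMem (fun h => htZ y h hy)]
    have hdisj : Disjoint (Z.erase y) R :=
      Finset.disjoint_of_subset_left (Finset.erase_subset y Z) hZR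
    rw [hsplit, Finset.sum_union hdisj] at h0
    -- in characteristic 2, `a + b = 0 → b = a`
    have := eq_neg_of_add_eq_zero_right h0
    rw [this, ZMod.neg_eq_self_mod_two]
  -- (d) swap over the off-diagonal pairs of `Z` and apply the kernel lemma in `Z`
  have hd' : ∑ y ∈ Z, dZ y * ∑ t ∈ Z.erase y, S y t * dY t =
      ∑ t ∈ Z, dY t * ∑ y ∈ Z.erase t, S t y * dZ y := by
    simp_rw [Finset.mul_sum]
    rw [Finset.sum_comm' (s' := fun t => Z.erase t) (t' := Z) (fun y t => by
      simp only [Finset.mem_erase]; tauto)]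
    refine Finset.sum_congr rfl fun t ht => Finset.sum_congr rfl fun y hy => ?_
    rw [hS.apply t y]
    ring
  rw [hab, Finset.sum_congr rfl fun y hy => by rw [hker y hy], hd']
  refine Finset.sum_eq_zero fun t ht => ?_
  rw [hdZ, sum_mul_det_principal_erase_eq_zero S hS hd Z ht, mul_zero]

end Expansion

end Summit.BirchSwinnertonDyer.Rank1Residual.X5.SelmerSolitaire.Matching
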